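import Summits.MatrixMultiplication.MatrixMultiplication.Theorems.ObstructionDescentSaturationWindow
import Summits.MatrixMultiplication.MatrixMultiplication.Theorems.ObstructionDescentDescentLaw

set_option linter.dupNamespace false

/-!
# Obstruction descent, part V — the aside `BlockLinearSaturation` in levels; its constant is at least `2`
# at every format carrying a level-`3` vector

`route-MatrixMultiplication-ObstructionDescent`, asides `BlockLinearSaturation` (stmt 33327) and `InvariantSaturation`
(stmt 32282); decomp-mm lens-3, NODE-g15.

* `blockLinearSaturation_iff_levels` — the item read in levels (its inlined weight-vector set is the carrier of
  `hwvSpace (rectType m N k) (kN)` by `rfl`, exactly as for `invariantSaturation_iff_levels`):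
  `BlockLinearSaturation ↔ ∃ c, ∀ N m, 1 ≤ N → cN ≤ m → ∀ k, k ∈ passLevels m N ∪ emptyLevels m N`.
* LOWER BOUNDS ON THE CONSTANT from the odd-level laws (parts P, T, U): if level `3` is non-empty at block format `N ≥ 2`
  (a Kronecker positivity `g((3^N)³) > 0`: classically `N ∈ {3,4,5,6,8,9}`), an admissible `c` has `3N ≤ 2cN + 1`
  (`le_of_blockLinear_levels_of_level_three`); at `N = 3` (Strassen's invariant) the descent law sharpens this to
  `c ≥ 2` (`two_le_of_blockLinear_levels`) — the conjectured value `c = 2` of the item is TIGHT from below in kernel,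
  modulo the classical non-emptiness `3 ∉ emptyLevels 3 3`.

[cite: BurgisserIkenmeyer2011, §3.1–3.2, §6.2], [cite: BurgisserIkenmeyer2017, §5 (5.2), Thm 5.3], [cite: LandsbergGCT2017, §8.3.4].
-/

noncomputable section

namespace Summit.MatrixMultiplication.MatrixMultiplication.Theorems.ObstructionCalculus

open Literature.Computability.AlgebraicComplexity (unitTensor)
open Summit.MatrixMultiplication.MatrixMultiplication.Theses.ObstructionDescent (BlockLinearSaturation)

section BlockLinearLevels

/-- **The item `BlockLinearSaturation` (stmt-MatrixMultiplication-33327) read in levels.** [bookkeeping] -/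
theorem blockLinearSaturation_iff_levels : BlockLinearSaturation ↔
    ∃ c : ℕ, ∀ N m : ℕ, 1 ≤ N → c * N ≤ m → ∀ k : ℕ, k ∈ passLevels m N ∪ emptyLevels m N := by
  unfold BlockLinearSaturation
  refine exists_congr fun c => forall_congr' fun N => forall_congr' fun m => forall_congr' fun _ =>
    forall_congr' fun _ => forall_congr' fun k => ⟨fun H => ?_, fun H W hW hU f hf => ?_⟩
  · by_cases hp : k ∈ passLevels m N
    · exact Or.inl hp
    · refine Or.inr ?_
      have hle : hwvSpace (rectType m N k) (k * N) ≤ orbitVanishing (unitTensor ℂ m) := by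
        by_contra h
        exact hp h
      show hwvSpace (rectType m N k) (k * N) = ⊥
      exact (Submodule.eq_bot_iff _).2 fun f hf => H _ rfl (fun g hg => hle hg) f hf
  · subst hW
    rcases H with hpass | hempty
    · have hle : hwvSpace (rectType m N k) (k * N) ≤ orbitVanishing (unitTensor ℂ m) :=
        fun g hg => hU g hg
      exact absurd hle hpass
    · have hbot : hwvSpace (rectType m N k) (k * N) = ⊥ := hempty
      exact (Submodule.eq_bot_iff _).1 hbot f hf

/-- **Lower bound on the constant at a format with a level-3 vector:** if the linear-scale dichotomy holds with constant
`c` and level `3` is non-empty at block format `N ≥ 2`, then `3N ≤ 2cN + 1`. [this node] -/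
theorem le_of_blockLinear_levels_of_level_three {c : ℕ}
    (hc : ∀ N m : ℕ, 1 ≤ N → c * N ≤ m → ∀ k : ℕ, k ∈ passLevels m N ∪ emptyLevels m N)
    {N : ℕ} (hN : 2 ≤ N) (h3 : 3 ∉ emptyLevels N N) : 3 * N ≤ 2 * (c * N) + 1 := by
  refine Nat.le_of_not_lt fun hlt => ?_
  have hNm : N ≤ max (c * N) N := le_max_right _ _
  have hcm : c * N ≤ max (c * N) N := le_max_left _ _
  have hm : 2 * max (c * N) N + 1 < 3 * N := by
    rcases le_total (c * N) N with h | h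
    · rw [max_eq_right h]; omega
    · rw [max_eq_left h]; omega
  exact not_dichotomy_level_three hN hNm hm h3 (hc N _ (by omega) hcm 3)

/-- The same for every odd level `k`: non-emptiness at block format `N ≥ 2` and the dichotomy at a cell `m ≥ cN`, `m ≥ N`
force `k(N−1) ≤ (k−1)(m−1)`. [this node] -/
theorem le_of_blockLinear_levels_of_odd {c : ℕ}
    (hc : ∀ N m : ℕ, 1 ≤ N → c * N ≤ m → ∀ k : ℕ, k ∈ passLevels m N ∪ emptyLevels m N)
    {N k m : ℕ} (hk : Odd k) (hN : 2 ≤ N) (hNm : N ≤ m) (hcm : c * N ≤ m) (hne : k ∉ emptyLevels N N) :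
    k * (N - 1) ≤ (k - 1) * (m - 1) := by
  refine Nat.le_of_not_lt fun hlt => ?_
  exact not_dichotomy_of_odd_diagonal hk hN hNm hlt hne (hc N m (by omega) hcm k)

/-- **`c ≥ 2` at `N = 3`:** level `3` of block format `3` does not pass at `m = 4` (descent law, part U), so a constant
`c ≤ 1` would force level `3` to be EMPTY at format `3` — i.e. no Strassen invariant. [this node] -/
theorem two_le_of_blockLinear_levels {c : ℕ}
    (hc : ∀ N m : ℕ, 1 ≤ N → c * N ≤ m → ∀ k : ℕ, k ∈ passLevels m N ∪ emptyLevels m N)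
    (h3 : 3 ∉ emptyLevels 3 3) : 2 ≤ c := by
  refine Nat.le_of_not_lt fun hlt => ?_
  have hcm : c * 3 ≤ 4 := by nlinarith
  rcases hc 3 4 (by norm_num) hcm 3 with hp | he
  · exact three_not_mem_passLevels_three (m := 4) (by norm_num) le_rfl hp
  · exact h3 ((mem_emptyLevels_iff_self (by norm_num : 3 ≤ 4)).mp he)

/-- Contrapositive packaging: `BlockLinearSaturation` with a witnessing constant `c ≤ 1` implies that level `3` is empty
at format `3`. [this node] -/
theorem three_mem_emptyLevels_three_of_blockLinear_levels_le_one {c : ℕ} (hc1 : c ≤ 1)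
    (hc : ∀ N m : ℕ, 1 ≤ N → c * N ≤ m → ∀ k : ℕ, k ∈ passLevels m N ∪ emptyLevels m N) :
    3 ∈ emptyLevels 3 3 := by
  by_contra h3
  have := two_le_of_blockLinear_levels hc h3
  omega

/-- The cells `(m, 3)` with `3 ≤ m ≤ 4`: the dichotomy at level `3` holds iff level `3` is empty at format `3`.
[this node] -/
theorem dichotomy_iff_empty_level_three_three {m : ℕ} (hm : 3 ≤ m) (hm4 : m ≤ 4) :
    (3 ∈ passLevels m 3 ∪ emptyLevels m 3) ↔ 3 ∈ emptyLevels 3 3 := by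
  rw [Set.mem_union, ← mem_emptyLevels_iff_self hm]
  exact ⟨fun h => h.resolve_left (three_not_mem_passLevels_three hm hm4), Or.inr⟩

end BlockLinearLevels

end Summit.MatrixMultiplication.MatrixMultiplication.Theorems.ObstructionCalculus

end
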